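import Mathlib
import HarnessLib
import Summits.HubbardSuperconductivity.HubbardSuperconductivity.Theorems.KLProgrammeKLRegimeSplitEngineV4
import Summits.HubbardSuperconductivity.HubbardSuperconductivity.Theorems.KLProgrammeKLRegimeVolumeLimitDefs

/-!
# Route `KLProgramme` — crux K3, VL child `KLRegimeVolumeLimitV17F2` (stmt-HubbardSuperconductivity-20440):
# THE SCALE-`n` SECTOR FAMILY VANISHES ON EVERY MATSUBARA LEG WITH `|ω| ≥ Λ_n`; AT THE LAST INDEX `n⋆ = nScales β + 1` IT VANISHES
# IDENTICALLY ON THE GRID, so every scale-`n⋆` sectorised kernel, kernel norm and the tower's (E1-v4)/(E4) clauses there are VACUOUS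
# (cell gate-hubbard-kl, seat hubbard-kl-k3c5-p3 g10, technique «OS-positivity-free direct assembly»; located risk VL-OBSERVABLE-SECTOR-g10)

Kernel-checked support for the located risk «VL-OBSERVABLE-SECTOR» (memo `VL-OBSERVABLE-SECTOR-g10.md`, evidence on 20440): the anisotropic
multipliers `klAnisoFamily … n = bgmMultiplier …` carry the infrared cutoff `C_{-n}⁻¹(√(ω² + e_K²)) = H₀(4ⁿ·√(ω² + e_K²))`, which is `0` as soon as
`4ⁿ·|ω| ≥ e₀`, i.e. `|ω| ≥ Λ_n = klScale klE0 n` (`gnCutoff_eq_zero`).  Hence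

* `bgmMultiplier_eq_zero_of_scale_le_abs_freq`, `klAnisoFamily_eq_zero_of_scale_le_abs_freq` — a leg whose Matsubara frequency has
  `Λ_n ≤ |ω|` is invisible to every scale-`n` sectorised kernel (`sectorisedKernel_eq_zero_of_leg`);
* `klAnisoFamily_nScales_succ_eq_zero` — at `n⋆ = nScales β + 1` (`Λ_{n⋆} < π/β ≤ |ω|`, [tree] `klScale_nScales_succ_lt`,
  `pi_div_le_abs_matsubaraFreq`) the family is IDENTICALLY ZERO on the grid; so `klAnisoLegKernel … n⋆ (m+1) ≡ 0`, `klAnisoLegKernelNorm … n⋆ (m+1) = 0`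
  (`sectorisedKernel_eq_zero_of_family_eq_zero`, `hubbardSectorKernelNorm_eq_zero_of_family_eq_zero`), and the tower clauses
  `KernelNormsV4 … n⋆` / `EngineFirstMoments … n⋆` hold for EVERY action as soon as their right-hand sides are nonnegative
  (`kernelNormsV4_nScales_succ_of_nonneg`, `engineFirstMoments_nScales_succ_of_nonneg`).

Consequence recorded in the memo (not a theorem here): a sector-field two-volume induction delivers, at the last index, no information at all, and at
index `n_β` only the labels `|ω| = π/β`, `√(ω² + e_K(p)²) < Λ_{n_β}`; the registered VL text quantifies over every Matsubara integer and every grid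
momentum.  Proofs only; no definition; nothing about the model beyond the support of the cutoff function is used.

References: BGM 2006 §2.3 (2.19), §2.5 (2.45)–(2.48), §2.4 (2.38).
-/

noncomputable section

namespace Summit.HubbardSuperconductivity.HubbardSuperconductivity.Theorems.TwoPointAssembly

set_option linter.dupNamespace false -- summit = problem name (single-conjunct summit), D-0017

open Finset Literature.MathematicalPhysics.QuantumLattice Literature.Probability.LatticeModels
open Summit.HubbardSuperconductivity.HubbardSuperconductivity.Theorems.KLRegimeSplit
open Summit.HubbardSuperconductivity.HubbardSuperconductivity.Theorems.KLProgrammeLegKernels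

/-! ## §1 Generic: a vanishing family kills every sectorised kernel of positive degree -/

section Generic

variable {L M : ℕ} [NeZero L] {N : ℕ}

/-- **A leg on which the multiplier vanishes kills the sectorised kernel**: if `F (Ω i) (k) = 0` for every momentum `k`, then
`W_{m+1,Ω} ≡ 0`. [folklore] -/
theorem sectorisedKernel_eq_zero_of_leg (β : ℝ) (F : Fin N → FreqMomentum L M → ℂ) (G : HubbardGrassmann L M) {m : ℕ}
    (Ω : Fin (m + 1) → SectorLeg N) (i : Fin (m + 1)) (hF : ∀ k, F (Ω i).1.1 k = 0) (x : Fin (m + 1) → SpaceTimeIdx L M) :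
    sectorisedKernel L M β F G (m + 1) Ω x = 0 := by
  rw [sectorisedKernel_def]
  refine sum_eq_zero fun k _ => ?_
  rw [prod_eq_zero (mem_univ i) (by rw [hF (k i), zero_mul]), zero_mul]

/-- **An identically vanishing family kills every sectorised kernel of positive degree.** [folklore] -/
theorem sectorisedKernel_eq_zero_of_family_eq_zero (β : ℝ) (F : Fin N → FreqMomentum L M → ℂ) (hF : ∀ ω k, F ω k = 0)
    (G : HubbardGrassmann L M) (m : ℕ) (Ω : Fin (m + 1) → SectorLeg N) (x : Fin (m + 1) → SpaceTimeIdx L M) :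
    sectorisedKernel L M β F G (m + 1) Ω x = 0 :=
  sectorisedKernel_eq_zero_of_leg β F G Ω 0 (fun k => hF _ k) x

/-- **… and every sectorised kernel norm of positive degree** (any constraint set, `0 ≤ β`). [folklore] -/
theorem hubbardSectorKernelNorm_eq_zero_of_family_eq_zero {β : ℝ} (hβ : 0 ≤ β) (F : Fin N → FreqMomentum L M → ℂ)
    (hF : ∀ ω k, F ω k = 0) {m : ℕ} (A : Finset (Fin (m + 1) → SectorLeg N)) (G : HubbardGrassmann L M) :
    hubbardSectorKernelNorm L M β F A G = 0 := by
  have hε : 0 ≤ imagTimeWeight β M := imagTimeWeight_nonneg hβ M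
  refine le_antisymm ?_ (hubbardSectorKernelNorm_nonneg hβ F A G)
  rw [hubbardSectorKernelNorm]
  refine sectorisedKernelNorm_le_of_forall_le le_rfl fun p s x => ?_
  rw [sectorLegSum_def]
  refine (sum_eq_zero fun Ω _ => ?_).le
  rw [sum_eq_zero fun X _ => by rw [sectorisedKernel_eq_zero_of_family_eq_zero β F hF G m Ω X, norm_zero], mul_zero]

end Generic

/-! ## §2 The BGM family at scale `n` vanishes on legs with `Λ_n ≤ |ω|`; at `n⋆ = nScales β + 1` it vanishes identically -/

section Model

variable {L M : ℕ}

/-- **The scale-`n` multiplier vanishes on a leg with `e₀·4⁻ⁿ ≤ |ω|`** (`0 < e₀`): `C_{-n}⁻¹(√(ω² + e²)) = H₀(4ⁿ√(ω² + e²)) = 0` because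
`4ⁿ√(ω² + e²) ≥ 4ⁿ|ω| ≥ e₀`. [cite: BenfattoGiulianiMastropietro2006, §2.3 (2.19)] -/
theorem bgmMultiplier_eq_zero_of_scale_le_abs_freq {e₀ : ℝ} (he : 0 < e₀) (β : ℝ) (e : TorusSite 2 L → ℝ) (n : ℕ)
    (ω : Fin (sectorCount n)) (k : FreqMomentum L M) (hk : e₀ * ((4 : ℝ) ^ n)⁻¹ ≤ |matsubaraFreq β M k.1|) :
    bgmMultiplier L M e₀ β e n ω k = 0 := by
  have h4 : (0 : ℝ) < (4 : ℝ) ^ n := by positivity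
  have hsqrt : |matsubaraFreq β M k.1| ≤ Real.sqrt (matsubaraFreq β M k.1 ^ 2 + e k.2 ^ 2) := by
    rw [← Real.sqrt_sq_eq_abs]
    exact Real.sqrt_le_sqrt (le_add_of_nonneg_right (sq_nonneg _))
  have ht : e₀ ≤ (4 : ℝ) ^ (-(-(n : ℤ))) * Real.sqrt (matsubaraFreq β M k.1 ^ 2 + e k.2 ^ 2) := by
    rw [neg_neg, zpow_natCast]
    have h1 : e₀ ≤ (4 : ℝ) ^ n * |matsubaraFreq β M k.1| := by
      have h0 : (4 : ℝ) ^ n * (e₀ * ((4 : ℝ) ^ n)⁻¹) = e₀ := by field_simp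
      have := mul_le_mul_of_nonneg_left hk h4.le
      rwa [h0] at this
    exact h1.trans (mul_le_mul_of_nonneg_left hsqrt h4.le)
  rw [bgmMultiplier, gnScaleCutoff, gnCutoff_eq_zero (by norm_num : (1 : ℝ) < 4) he ht, zero_mul, Complex.ofReal_zero]

/-- **The KL family at scale `n` vanishes on a leg with `Λ_n ≤ |ω|`** (`Λ_n = klScale klE0 n`). [folklore] -/
theorem klAnisoFamily_eq_zero_of_scale_le_abs_freq (β μ : ℝ) (K : TrigPolyC4v) (n : ℕ) (ω : Fin (sectorCount n))
    (k : FreqMomentum L M) (hk : klScale klE0 n ≤ |matsubaraFreq β M k.1|) :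
    klAnisoFamily L M β μ K klE0 n ω k = 0 :=
  bgmMultiplier_eq_zero_of_scale_le_abs_freq (by unfold klE0; norm_num) β (nambuXiCT L μ K) n ω k
    (by simpa [klScale] using hk)

/-- **At a scale below temperature the KL family vanishes identically on the Matsubara grid**: `Λ_n ≤ π/β`, `0 < β`. [folklore] -/
theorem klAnisoFamily_eq_zero_of_scale_le_pi_div {β : ℝ} (hβ : 0 < β) (μ : ℝ) (K : TrigPolyC4v) {n : ℕ}
    (hn : klScale klE0 n ≤ Real.pi / β) (ω : Fin (sectorCount n)) (k : FreqMomentum L M) :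
    klAnisoFamily L M β μ K klE0 n ω k = 0 :=
  klAnisoFamily_eq_zero_of_scale_le_abs_freq β μ K n ω k
    (hn.trans (Literature.MathematicalPhysics.QuantumLattice.pi_div_le_abs_matsubaraFreq hβ k.1))

/-- **THE LAST-INDEX FAMILY IS ZERO**: `klAnisoFamily … (nScales β + 1) ≡ 0` on the grid (`0 < β`; [tree] `klScale_nScales_succ_lt`).
[cite: BenfattoGiulianiMastropietro2006, §2.4 (2.38)] -/
theorem klAnisoFamily_nScales_succ_eq_zero {β : ℝ} (hβ : 0 < β) (μ : ℝ) (K : TrigPolyC4v) (ω : Fin (sectorCount (nScales β + 1)))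
    (k : FreqMomentum L M) : klAnisoFamily L M β μ K klE0 (nScales β + 1) ω k = 0 :=
  klAnisoFamily_eq_zero_of_scale_le_pi_div hβ μ K (klScale_nScales_succ_lt hβ).le ω k

/-- **Every scale-`n⋆` sectorised leg kernel of positive degree vanishes**, for EVERY element of the algebra in the slot of the action
(here the tower's `klEffectiveAction`). [folklore] -/
theorem klAnisoLegKernel_nScales_succ_eq_zero [NeZero L] {β : ℝ} (hβ : 0 < β) (U μ : ℝ) (K : TrigPolyC4v) (m : ℕ)
    (Ω : Fin (m + 1) → SectorLeg (sectorCount (nScales β + 1))) (x : Fin (m + 1) → SpaceTimeIdx L M) :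
    klAnisoLegKernel L M β U μ K klE0 (nScales β + 1) (m + 1) Ω x = 0 :=
  sectorisedKernel_eq_zero_of_family_eq_zero β _ (klAnisoFamily_nScales_succ_eq_zero hβ μ K) _ m Ω x

/-- **Every scale-`n⋆` sectorised kernel NORM of positive degree vanishes.** [folklore] -/
theorem klAnisoLegKernelNorm_nScales_succ_eq_zero [NeZero L] {β : ℝ} (hβ : 0 < β) (U μ : ℝ) (K : TrigPolyC4v) (m : ℕ) :
    klAnisoLegKernelNorm L M β U μ K klE0 (nScales β + 1) (m + 1) = 0 :=
  hubbardSectorKernelNorm_eq_zero_of_family_eq_zero hβ.le _ (klAnisoFamily_nScales_succ_eq_zero hβ μ K) _ _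

/-- **At index `n_β = nScales β` the family sees only the labels `|ω| < Λ_{n_β}`**: on a leg with `Λ_{n_β} ≤ |ω|` (in particular every
`|ω| ≥ 3π/β` once `Λ_{n_β} ≤ 3π/β`, and EVERY `|ω| ≠ π/β` when `Λ_{n_β} ≤ 3π/β`) the scale-`n_β` multiplier vanishes. [folklore] -/
theorem klAnisoFamily_nScales_eq_zero_of_le {β : ℝ} (μ : ℝ) (K : TrigPolyC4v) (ω : Fin (sectorCount (nScales β)))
    (k : FreqMomentum L M) (hk : klScale klE0 (nScales β) ≤ |matsubaraFreq β M k.1|) :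
    klAnisoFamily L M β μ K klE0 (nScales β) ω k = 0 :=
  klAnisoFamily_eq_zero_of_scale_le_abs_freq β μ K _ ω k hk

/-- **(E1-v4) AT THE LAST INDEX IS VACUOUS**: `KernelNormsV4 … K (nScales β + 1)` holds whenever its budgets are nonnegative — for every
coupling, frame and potential, whatever the action. [folklore] -/
theorem kernelNormsV4_nScales_succ_of_nonneg [NeZero L] {β : ℝ} (hβ : 0 < β) (P : SplitConsts) (Q : EngConsts) (U μ : ℝ) (K : TrigPolyC4v)
    (hQ : 0 ≤ Q.CE) (hε : 0 ≤ epsCoupling P U (nScales β + 1)) :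
    KernelNormsV4 L M P Q β U μ K (nScales β + 1) := by
  intro p hp
  obtain ⟨q, hq⟩ : ∃ q, 2 * p = q + 1 := ⟨2 * p - 1, by omega⟩
  rw [hq, klAnisoLegKernelNorm_nScales_succ_eq_zero hβ]
  positivity

/-- **(E4) AT THE LAST INDEX IS VACUOUS**: `EngineFirstMoments … K (nScales β + 1)` holds whenever its right-hand side is nonnegative.
[folklore] -/
theorem engineFirstMoments_nScales_succ_of_nonneg [NeZero L] [NeZero M] {β : ℝ} (hβ : 0 < β) (G : GeoConsts) (P : SplitConsts) (Q : EngConsts) (U μ : ℝ)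
    (K : TrigPolyC4v) (hrhs : 0 ≤ (G.cE4 + Q.cE4 * |U|) * P.Klam * |U| * (4 : ℝ) ^ (nScales β + 1)) :
    EngineFirstMoments L M G P Q β U μ K (nScales β + 1) := by
  intro Ω i k
  refine le_trans (le_of_eq ?_) hrhs
  rw [sum_eq_zero fun x _ => ?_, mul_zero]
  rw [klAnisoLegKernel_nScales_succ_eq_zero hβ, norm_zero, mul_zero]

end Model

end Summit.HubbardSuperconductivity.HubbardSuperconductivity.Theorems.TwoPointAssembly
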